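import Summits.BirchSwinnertonDyer.BirchSwinnertonDyer.Theorems.ManinLocalTwoThreeNoTriplingIIIstarNineP
import Summits.BirchSwinnertonDyer.BirchSwinnertonDyer.Theorems.ManinLocalTwoThreeTameThreeNeronScalarIII
import Summits.BirchSwinnertonDyer.BirchSwinnertonDyer.Theorems.ManinLocalTwoThreeVeluThreeDiscriminant
import HarnessLib

/-!
# The tripling profile at `N = 9p`: `ord₃ Δ_min(W₁) + 4·ord₃ D₀ = 3·ord₃ Δ_min(W₀)` along the Vélu line; a tripled class with
# `X₀`-optimal curve of type `III` has `X₁`-optimal curve of type `III*`; type `III*` (pot. good) never triples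

Summit `BirchSwinnertonDyer`, route `ManinLocalTwoThree` (cell bsd-f2-manin), deciding crux C3 `ManinPrimeToThreeAtNine`
(stmt-BirchSwinnertonDyer-22968).  Composition of p3-g6's `velu_three_of_tripled_nine_mul_prime` (tripling `|c₀| = 3|c₁|` at `N = 9p`,
`p ≡ 2 (3)`, ⟹ the globally minimal `W₁` carries the `u = 1` Vélu `3`-pair of `W₀` at a rational `3`-line `q`) with this seat's
p645802 (`padicValRat_velu_three_Δ`: `ord_p Δ(T) + 4·ord_p D₀ = 3·ord_p Δ(W₀)`, `D₀ = Ψ₂²(q − b₂/12)`), p643391 (E-an-107.2: on `III` the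
`u = 1` carrier has `ord₃ Δ_min = 9`) and p642959 (no tripling on `III*`):

* `exists_tripling_profile_nine_mul_prime` — tripled ⟹ `∃ q`, `Ψ₃(q − b₂/12) = 0`, `W₁` carries the pair, and
  `ord₃ Δ_min(W₁) + 4·ord₃ D₀(q) = 3·ord₃ Δ_min(W₀)` (indeed at every prime).
* `padicValInt_minimalDiscriminantInt₁_eq_nine_of_tripled_of_III` — tripled, `ord₃ Δ_min(W₀) = 3` ⟹ `ord₃ Δ_min(W₁) = 9` (granted
  `exists_isNewformOf` for `9 ∥ N(W₀)`; also the modularity-free form).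
* `tripling_profile_nine_mul_prime` — tripled ⟹ `ord₃ Δ_min(W₀) ≠ 9 ∨ ord₃ j(W₀) < 0`, and `ord₃ Δ_min(W₀) = 3 → ord₃ Δ_min(W₁) = 9`.

HONEST FRAMING: C3, Manin's conjecture and BSD are not proved; which end of the isogeny is `X₀`-optimal is a POSITION LAW (global, not
claimed).  No definitions, no named facts, no sorry.  References: [CesnaviciusNeururerSaha2023] Lemma 6.5; [SilvermanATAEC1994] IV.9.4
Table 4.1; [DokchitserDokchitser2015LocalInvariants] Table 1; [DiamondShurman2005] Thm. 8.8.1; HOME/MEMO-an.md §66–§67.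
-/

set_option autoImplicit false
set_option linter.dupNamespace false

noncomputable section

open scoped Classical
open WeierstrassCurve Literature.NumberTheory.EllipticCurves Literature.NumberTheory.EllipticCurves.ModularForms
open CongruenceSubgroup Polynomial

namespace Summit.BirchSwinnertonDyer.BirchSwinnertonDyer.Theorems.ManinLocalTwoThree

variable {W₁ W₀ : WeierstrassCurve ℚ} [W₁.IsElliptic] [W₁.IsGloballyMinimal] [W₀.IsElliptic]
  [W₀.IsGloballyMinimal]

/-- **The tripling profile at `9p` (every prime):** tripled ⟹ there is a rational `3`-line `q` of `W₀` with `W₁` carrying its `u = 1`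
Vélu pair and `ord_ℓ Δ_min(W₁) + 4·ord_ℓ Ψ₂²_{W₀}(q − b₂/12) = 3·ord_ℓ Δ_min(W₀)` at every prime `ℓ`.
[cite: CesnaviciusNeururerSaha2023, Lemma 6.5] [cite: DokchitserDokchitser2015LocalInvariants, Table 1] -/
theorem exists_tripling_profile_nine_mul_prime {p : ℕ} (hp : p.Prime) (hp3 : p % 3 = 2) [NeZero (9 * p)]
    (D₁ : Gamma1ParametrizationData W₁ (9 * p)) (D₀ : ModularParametrizationData W₀ (9 * p))
    (hiso : IsIsogenous W₁ W₀) (h₁ : D₁.IsOptimal)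
    (h₀ : ∀ z ∈ D₀.L.lattice, ∃ w ∈ periodLattice D₀.f, z = D₀.c * w)
    (htri : D₀.maninConstant.natAbs = 3 * D₁.maninConstant.natAbs) :
    ∃ q : ℚ, W₀.Ψ₃.eval (q - W₀.b₂ / 12) = 0 ∧ W₁.c₄ = 1440 * q ^ 2 - 9 * W₀.c₄ ∧
      W₁.c₆ = 60480 * q ^ 3 - 756 * W₀.c₄ * q - 27 * W₀.c₆ ∧
      ∀ (ℓ : ℕ) [Fact ℓ.Prime], (padicValInt ℓ W₁.minimalDiscriminantInt : ℤ) +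
        4 * padicValRat ℓ (W₀.Ψ₂Sq.eval (q - W₀.b₂ / 12)) = 3 * padicValInt ℓ W₀.minimalDiscriminantInt := by
  obtain ⟨q, hq, h4, h6⟩ := velu_three_of_tripled_nine_mul_prime hp hp3 D₁ D₀ hiso h₁ h₀ htri
  refine ⟨q, hq, h4, h6, fun ℓ _ ↦ ?_⟩
  have h := padicValRat_velu_three_Δ ℓ W₀ q hq W₁ h4 h6
  rw [← cast_minimalDiscriminantInt W₁, ← cast_minimalDiscriminantInt W₀, padicValRat.of_int, padicValRat.of_int] at h
  exact h

/-- **Tripled with `X₀`-optimal curve of type `III` ⟹ the `X₁`-optimal curve is of type `III*`** (modularity-free form: `9 ∥ N(W₀)` as a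
hypothesis). [cite: SilvermanATAEC1994, IV.9.4 Table 4.1] [cite: CesnaviciusNeururerSaha2023, Lemma 6.5] -/
theorem padicValInt_minimalDiscriminantInt₁_eq_nine_of_tripled_of_III_of_tame {p : ℕ} (hp : p.Prime) (hp3 : p % 3 = 2)
    [NeZero (9 * p)] (D₁ : Gamma1ParametrizationData W₁ (9 * p)) (D₀ : ModularParametrizationData W₀ (9 * p))
    (hiso : IsIsogenous W₁ W₀) (h₁ : D₁.IsOptimal)
    (h₀ : ∀ z ∈ D₀.L.lattice, ∃ w ∈ periodLattice D₀.f, z = D₀.c * w)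
    (h9 : 3 ^ 2 ∣ W₀.conductorNorm ℤ) (h27 : ¬ 3 ^ 3 ∣ W₀.conductorNorm ℤ)
    (hΔ3 : padicValInt 3 W₀.minimalDiscriminantInt = 3)
    (htri : D₀.maninConstant.natAbs = 3 * D₁.maninConstant.natAbs) :
    padicValInt 3 W₁.minimalDiscriminantInt = 9 := by
  obtain ⟨q, hq, h4, h6⟩ := velu_three_of_tripled_nine_mul_prime hp hp3 D₁ D₀ hiso h₁ h₀ htri
  exact padicValInt_minimalDiscriminantInt_eq_nine_of_velu_three_of_III W₀ h9 h27 hΔ3 q hq W₁ h4 h6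

/-- **Tripled with `X₀`-optimal curve of type `III` ⟹ `X₁`-optimal curve of type `III*`, at `N = 9p`** (granted `exists_isNewformOf` for
`9 ∥ N(W₀)`). [cite: SilvermanATAEC1994, IV.9.4 Table 4.1] [cite: DiamondShurman2005, Thm. 8.8.1] -/
theorem padicValInt_minimalDiscriminantInt₁_eq_nine_of_tripled_of_III (hnf : exists_isNewformOf) {p : ℕ} (hp : p.Prime)
    (hp3 : p % 3 = 2) [NeZero (9 * p)] (D₁ : Gamma1ParametrizationData W₁ (9 * p)) (D₀ : ModularParametrizationData W₀ (9 * p))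
    (hiso : IsIsogenous W₁ W₀) (h₁ : D₁.IsOptimal)
    (h₀ : ∀ z ∈ D₀.L.lattice, ∃ w ∈ periodLattice D₀.f, z = D₀.c * w)
    (hΔ3 : padicValInt 3 W₀.minimalDiscriminantInt = 3)
    (htri : D₀.maninConstant.natAbs = 3 * D₁.maninConstant.natAbs) :
    padicValInt 3 W₁.minimalDiscriminantInt = 9 := by
  obtain ⟨h9, h27⟩ := nine_dvd_not_twentyseven_dvd_conductorNorm_of_level_nine_mul_prime hnf hp hp3 D₀
  exact padicValInt_minimalDiscriminantInt₁_eq_nine_of_tripled_of_III_of_tame hp hp3 D₁ D₀ hiso h₁ h₀ h9 h27 hΔ3 htri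

/-- **The tripling profile at `N = 9p` on the tame strata of this seat:** tripled ⟹ (`ord₃ Δ_min(W₀) = 9 → ord₃ j(W₀) < 0`) ∧
(`ord₃ Δ_min(W₀) = 3 → ord₃ Δ_min(W₁) = 9`). [cite: CesnaviciusNeururerSaha2023, Lemma 6.5] [cite: SilvermanATAEC1994, IV.9.4 Table 4.1] -/
theorem tripling_profile_nine_mul_prime (hnf : exists_isNewformOf) {p : ℕ} (hp : p.Prime) (hp3 : p % 3 = 2) [NeZero (9 * p)]
    (D₁ : Gamma1ParametrizationData W₁ (9 * p)) (D₀ : ModularParametrizationData W₀ (9 * p))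
    (hiso : IsIsogenous W₁ W₀) (h₁ : D₁.IsOptimal)
    (h₀ : ∀ z ∈ D₀.L.lattice, ∃ w ∈ periodLattice D₀.f, z = D₀.c * w)
    (htri : D₀.maninConstant.natAbs = 3 * D₁.maninConstant.natAbs) :
    (padicValInt 3 W₀.minimalDiscriminantInt = 9 → padicValRat 3 W₀.j < 0) ∧
      (padicValInt 3 W₀.minimalDiscriminantInt = 3 → padicValInt 3 W₁.minimalDiscriminantInt = 9) := by
  obtain ⟨h9, h27⟩ := nine_dvd_not_twentyseven_dvd_conductorNorm_of_level_nine_mul_prime hnf hp hp3 D₀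
  refine ⟨fun hΔ9 ↦ ?_, fun hΔ3 ↦
    padicValInt_minimalDiscriminantInt₁_eq_nine_of_tripled_of_III_of_tame hp hp3 D₁ D₀ hiso h₁ h₀ h9 h27 hΔ3 htri⟩
  by_contra hj
  rw [not_lt] at hj
  exact natAbs_maninConstant₀_ne_three_mul_of_IIIstar_nine_mul_prime hp hp3 D₁ D₀ hiso h₁ h₀ h9 h27 hΔ9 hj htri

end Summit.BirchSwinnertonDyer.BirchSwinnertonDyer.Theorems.ManinLocalTwoThree

end
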